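import Literature.NumberTheory.IwasawaTheory.Greenberg2006.CohomologyCofinitelyGeneratedGlobalLowDegree
import Literature.NumberTheory.IwasawaTheory.Greenberg2006.CofiniteGenerationCriterion
import Literature.NumberTheory.IwasawaTheory.IwasawaAlgebraTwoVar
import Summits.BirchSwinnertonDyer.BirchSwinnertonDyer.Theorems.EisensteinPrimesBSDpOnCellCTelescopeK2SelmerDictionary
import HarnessLib

/-!
# Crux 4 `BSDpOnCellC` (stmt-BirchSwinnertonDyer-19034), line «telescope», leaf K2-M♭ / N2, sub-leaf W1 (fg), route R1′:
# a Selmer group of a `Γ_K`-representation unramified outside a finite `S` is COFINITELY GENERATED (helper; closes nothing)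

Route `EisensteinPrimes`, crux `BSDpOnCellC`; ideator seat `bsd-idea-12` (gen 36), `--supports
stmt-BirchSwinnertonDyer-19034 --as helper`. THEOREMS + one bookkeeping `def` (`selmerToH1`, a section of
inflation on the Selmer group); no instance, no named fact, no `sorry`. HONEST FRAMING: generic finiteness
bookkeeping; proves no crux, no registered stub, no summit statement; BSD is proved for no curve here.
(Imports the landed dictionary `…TelescopeK2SelmerDictionary` (p747353) for the injectivity of inflation.)

WHAT. Leaf N2 (`stub_weightTwoControl` of telescope v8) has the sub-leaf W1 `Module.Finite B X₂` for the
branch's big dual Selmer module `X₂ = XBig κ ρ₂ 𝔭̄ ∅ = (Sel^∅_{𝔭̄}(K, M₂))^∨`, `B = ℤ_p⟦X⟧⟦T⟧`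
(memo `Cruxes/BSDpOnCellC/W-PRICING-n2.md`, §W1, route R1′). This file proves the GENERIC statement behind it:

* §1 `selmer_le_range_resH1`: for `ρ : ContinuousRep (GaloisGroupUnramifiedOutside K S) Λ D` (`D` discrete)
  and an index set `L₀` containing the inertia index `Sum.inr w` of every `w ∉ S`, the K2 Selmer group
  `Sel_{L₀}(K, D) = TorsionControl.selmer (localMap K) L₀ (ρ.restrict θ)` lies in the image of inflation
  `resH1 ρ θ : H¹(G_{K,S}, D) → H¹(Γ_K, D)` (`TelescopeK2SelmerInflation.exists_resH1_eq_of_mem_selmer`,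
  p745239); `selmerToH1` — the resulting `Λ`-linear SECTION `Sel_{L₀}(K, D) → H¹(G_{K,S}, D)`
  (`resH1_selmerToH1`, `selmerToH1_injective`; inflation is injective in degree 1,
  `TelescopeK2SelmerDictionary.resH1_toUnramifiedQuotCont_injective`, p747353);
* §2 `isCofinitelyGenerated_selmer_restrict` / `…_of_H_one`: `Sel_{L₀}(K, D)` is cofinitely generated as soon
  as `H¹(G_{K,S}, D)` is (`Greenberg2006.IsCofinitelyGenerated.of_injective`), for `ρ` over `G_{K,S}` and —
  via the definitional descent `TelescopeK2RepDescent.descendUnramified` (p746306) — for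
  `ρ₀ : ContinuousRep Γ_K Λ D` with `N_S ≤ ker ρ₀`;
* §3 **`isCofinitelyGenerated_selmer`** / **`module_finite_characterModule_selmer`**: for
  `Λ ≃+* ℤ_p⟦T₁, …, T_m⟧`, `D` cofinitely generated, `S` FINITE and `N_S ≤ ker ρ₀`:
  `Sel_{L₀}(K, D)^∨ = CharacterModule (selmer (localMap K) L₀ ρ₀)` is a finitely generated `Λ`-module —
  Greenberg 2006 Prop. 3.2 for `H¹(K_S/K, D)` (tree: `Greenberg2006.isCofinitelyGenerated_H_one`, proved
  unconditionally from Hermite–Minkowski) plus §1–§2;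
* §4 the K2 reading **`module_finite_XBig`**: `Module.Finite (PowerSeries 𝒪) (XBig κ ρ 𝔮 Σ)` for the
  anticyclotomic big Galois representation `M = AnticyclotomicBigGaloisRep κ ρ` with `PowerSeries 𝒪 ≃+*
  ℤ_p⟦T₁, …, T_m⟧` (for the K2 branch: `𝒪 = 𝒪₂ = ℤ_p⟦X⟧`, `m = 2`, the tree's
  `nonempty_iwasawaAlgebraTwoVar_ringEquiv_mvPowerSeries`), GIVEN (a) `IsCofinitelyGenerated (PowerSeries 𝒪) M`
  (the branch-lattice input of leaf N1: `M₂ ≅ (B^*)²`), (b) `M` unramified outside a finite `S ∋ 𝔮` containing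
  `Σ` and the primes above `p` (`N_S ≤ ker`, e.g. by `TelescopeK2RepDescent.ramificationSubgroup_le_ker_of_forall_localMap`).
  This is sub-leaf W1 of the memo modulo (a) and (b) — both belong to the CONSTRUCTION node N1, not to N2;
  `module_finite_XBig_twoVar` is the literal K2 branch case `B = ℤ_p⟦X⟧⟦T⟧` (ring clause discharged by
  `nonempty_iwasawaAlgebraTwoVar_ringEquiv_mvPowerSeries`).

References: R. Greenberg, *On the structure of certain Galois cohomology groups*, Doc. Math. Extra Vol.
Coates (2006), Prop. 3.2 (p. 358) [Greenberg2006]; [NeukirchSchmidtWingberg2008] (8.3.20)(i) (finiteness of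
`H¹(G_{K,S}, A)` for finite `A`); [Castella2018Erratum] §2 (`Sel^Σ_𝔮 ⊆ H¹(G_{K,S}, M)`).

## References
[cite: Greenberg2006, Prop. 3.2 (p. 358 L37)] [cite: NeukirchSchmidtWingberg2008, (8.3.20) (i)] [cite: Castella2018Erratum, §2 (p. 2)]
-/

set_option linter.dupNamespace false
set_option autoImplicit false

noncomputable section

open Field IsDedekindDomain NumberField Topology CategoryTheory
open Literature.NumberTheory.GaloisRepresentations Literature.NumberTheory.EllipticCurves
open Literature.NumberTheory.IwasawaTheory
open Summit.BirchSwinnertonDyer.Rank1Residual.X11b.TorsionControl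
open scoped NumberField ContRepresentation

namespace Summit.BirchSwinnertonDyer.BirchSwinnertonDyer.Theorems.TelescopeK2SelmerCofinite

/-! ## §1. The Selmer group as a submodule of `H¹(G_{K,S}, D)` -/

section Section

variable {K : Type} [Field K] [NumberField K] (S : Set (HeightOneSpectrum (𝓞 K)))
  {Λ : Type} [CommRing Λ] [TopologicalSpace Λ]
  {D : Type} [AddCommGroup D] [Module Λ D] [TopologicalSpace D] [DiscreteTopology D] [ContinuousSMul Λ D]
  (ρ : ContinuousRep (GaloisGroupUnramifiedOutside K S) Λ D)

/-- **`Sel_{L₀}(K, D) ⊆ infl(H¹(G_{K,S}, D))`** when `L₀ ∋ Sum.inr w` for every `w ∉ S` (every Selmer class is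
unramified off `S`, hence inflated: `TelescopeK2SelmerInflation.exists_resH1_eq_of_mem_selmer`).
[cite: Castella2018Erratum, §2 (p. 2, "`Sel^Σ_𝔮(K, M) = ker{H¹(G_{K,S}, M) → …}`")] -/
theorem selmer_le_range_resH1 (L₀ : Set (BigGaloisRep.LocalIndex K))
    (hL : ∀ w : HeightOneSpectrum (𝓞 K), w ∉ S → (Sum.inr w : BigGaloisRep.LocalIndex K) ∈ L₀) :
    selmer (BigGaloisRep.localMap K) L₀ (ρ.restrict (toUnramifiedQuotCont K S)) ≤
      LinearMap.range (resH1 ρ (toUnramifiedQuotCont K S)).hom.toLinearMap := by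
  intro x hx
  obtain ⟨y, hy⟩ := TelescopeK2SelmerInflation.exists_resH1_eq_of_mem_selmer K S ρ L₀ hL hx
  exact ⟨y, hy⟩

/-- **The section `Sel_{L₀}(K, D) → H¹(G_{K,S}, D)`** of inflation on the Selmer group (the unique
`G_{K,S}`-class inflating to a given Selmer class). [folklore] -/
def selmerToH1 (L₀ : Set (BigGaloisRep.LocalIndex K))
    (hL : ∀ w : HeightOneSpectrum (𝓞 K), w ∉ S → (Sum.inr w : BigGaloisRep.LocalIndex K) ∈ L₀) :
    selmer (BigGaloisRep.localMap K) L₀ (ρ.restrict (toUnramifiedQuotCont K S)) →ₗ[Λ] ρ.H 1 :=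
  (LinearEquiv.ofInjective (resH1 ρ (toUnramifiedQuotCont K S)).hom.toLinearMap
        (TelescopeK2SelmerDictionary.resH1_toUnramifiedQuotCont_injective S ρ)).symm.toLinearMap ∘ₗ
    Submodule.inclusion (selmer_le_range_resH1 S ρ L₀ hL)

/-- `selmerToH1` is a section of inflation: `infl (selmerToH1 x) = x`. [folklore] -/
@[simp] theorem resH1_selmerToH1 (L₀ : Set (BigGaloisRep.LocalIndex K))
    (hL : ∀ w : HeightOneSpectrum (𝓞 K), w ∉ S → (Sum.inr w : BigGaloisRep.LocalIndex K) ∈ L₀)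
    (x : selmer (BigGaloisRep.localMap K) L₀ (ρ.restrict (toUnramifiedQuotCont K S))) :
    resH1 ρ (toUnramifiedQuotCont K S) (selmerToH1 S ρ L₀ hL x) =
      (x : continuousCohomology 1 (ρ.restrict (toUnramifiedQuotCont K S)).toTopRep) := by
  change (resH1 ρ (toUnramifiedQuotCont K S)).hom.toLinearMap
      ((LinearEquiv.ofInjective (resH1 ρ (toUnramifiedQuotCont K S)).hom.toLinearMap
          (TelescopeK2SelmerDictionary.resH1_toUnramifiedQuotCont_injective S ρ)).symm
        (Submodule.inclusion (selmer_le_range_resH1 S ρ L₀ hL) x)) =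
    ((Submodule.inclusion (selmer_le_range_resH1 S ρ L₀ hL) x :
        LinearMap.range (resH1 ρ (toUnramifiedQuotCont K S)).hom.toLinearMap) :
      continuousCohomology 1 (ρ.restrict (toUnramifiedQuotCont K S)).toTopRep)
  exact congrArg Subtype.val
    ((LinearEquiv.ofInjective (resH1 ρ (toUnramifiedQuotCont K S)).hom.toLinearMap
        (TelescopeK2SelmerDictionary.resH1_toUnramifiedQuotCont_injective S ρ)).apply_symm_apply
      (Submodule.inclusion (selmer_le_range_resH1 S ρ L₀ hL) x))

/-- `selmerToH1` is injective. [folklore] -/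
theorem selmerToH1_injective (L₀ : Set (BigGaloisRep.LocalIndex K))
    (hL : ∀ w : HeightOneSpectrum (𝓞 K), w ∉ S → (Sum.inr w : BigGaloisRep.LocalIndex K) ∈ L₀) :
    Function.Injective (selmerToH1 S ρ L₀ hL) := fun a b h ↦
  Subtype.ext (by rw [← resH1_selmerToH1 S ρ L₀ hL a, ← resH1_selmerToH1 S ρ L₀ hL b, h])

/-! ## §2. Cofinite generation is inherited from `H¹(G_{K,S}, D)` -/

/-- **`Sel_{L₀}(K, D)` is cofinitely generated if `H¹(G_{K,S}, D)` is** (it injects `Λ`-linearly: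
`Greenberg2006.IsCofinitelyGenerated.of_injective`). [cite: Greenberg2006, §3 A (p. 358 L35–36)] -/
theorem isCofinitelyGenerated_selmer_restrict (hH : Greenberg2006.IsCofinitelyGenerated Λ (ρ.H 1))
    (L₀ : Set (BigGaloisRep.LocalIndex K))
    (hL : ∀ w : HeightOneSpectrum (𝓞 K), w ∉ S → (Sum.inr w : BigGaloisRep.LocalIndex K) ∈ L₀) :
    Greenberg2006.IsCofinitelyGenerated Λ
      (selmer (BigGaloisRep.localMap K) L₀ (ρ.restrict (toUnramifiedQuotCont K S))) :=
  hH.of_injective _ (selmerToH1_injective S ρ L₀ hL)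

/-- The same for a `Γ_K`-representation `ρ₀` with `N_S ≤ ker ρ₀`, through the definitional descent
`TelescopeK2RepDescent.descendUnramified` (`(descend ρ₀).restrict θ = ρ₀` by `rfl`).
[cite: Greenberg2006, §3 A (p. 358 L35–36)] -/
theorem isCofinitelyGenerated_selmer_of_H_one (ρ₀ : ContinuousRep (absoluteGaloisGroup K) Λ D)
    (hker : ramificationSubgroup K S ≤ ρ₀.ker)
    (hH : Greenberg2006.IsCofinitelyGenerated Λ ((TelescopeK2RepDescent.descendUnramified S ρ₀ hker).H 1))
    (L₀ : Set (BigGaloisRep.LocalIndex K))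
    (hL : ∀ w : HeightOneSpectrum (𝓞 K), w ∉ S → (Sum.inr w : BigGaloisRep.LocalIndex K) ∈ L₀) :
    Greenberg2006.IsCofinitelyGenerated Λ (selmer (BigGaloisRep.localMap K) L₀ ρ₀) :=
  isCofinitelyGenerated_selmer_restrict S (TelescopeK2RepDescent.descendUnramified S ρ₀ hker) hH L₀ hL

/-! ## §3. Greenberg 2006 Prop. 3.2 ⟹ Selmer groups over `Λ ≅ ℤ_p⟦T₁,…,T_m⟧` are cofinitely generated -/

/-- **`Sel_{L₀}(K, D)` IS COFINITELY GENERATED** for `Λ ≃+* ℤ_p⟦T₁, …, T_m⟧`, `D` a discrete cofinitely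
generated `Λ`-module with a continuous `Λ`-linear `Γ_K`-action UNRAMIFIED OUTSIDE A FINITE `S`
(`N_S ≤ ker ρ₀`), and any index set `L₀ ∋ Sum.inr w` (`w ∉ S`): Greenberg 2006 Prop. 3.2 for `H¹(K_S/K, D)`
(`Greenberg2006.isCofinitelyGenerated_H_one`, unconditional) and §2.
[cite: Greenberg2006, Prop. 3.2 (p. 358 L37)] [cite: NeukirchSchmidtWingberg2008, (8.3.20) (i)] -/
theorem isCofinitelyGenerated_selmer {p : ℕ} [Fact p.Prime] {m : ℕ} (e : Λ ≃+* MvPowerSeries (Fin m) ℤ_[p])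
    (hD : Greenberg2006.IsCofinitelyGenerated Λ D) (hS : S.Finite)
    (ρ₀ : ContinuousRep (absoluteGaloisGroup K) Λ D) (hker : ramificationSubgroup K S ≤ ρ₀.ker)
    (L₀ : Set (BigGaloisRep.LocalIndex K))
    (hL : ∀ w : HeightOneSpectrum (𝓞 K), w ∉ S → (Sum.inr w : BigGaloisRep.LocalIndex K) ∈ L₀) :
    Greenberg2006.IsCofinitelyGenerated Λ (selmer (BigGaloisRep.localMap K) L₀ ρ₀) :=
  isCofinitelyGenerated_selmer_of_H_one S ρ₀ hker
    (Greenberg2006.isCofinitelyGenerated_H_one S (TelescopeK2RepDescent.descendUnramified S ρ₀ hker) e hD hS)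
    L₀ hL

/-- **The Pontryagin dual `Sel_{L₀}(K, D)^∨` is a finitely generated `Λ`-module** (same hypotheses; the
canonical-dual reading `Greenberg2006.isCofinitelyGenerated_iff_module_finite_characterModule`).
[cite: Greenberg2006, Prop. 3.2 (p. 358 L37)] -/
theorem module_finite_characterModule_selmer {p : ℕ} [Fact p.Prime] {m : ℕ}
    (e : Λ ≃+* MvPowerSeries (Fin m) ℤ_[p]) (hD : Greenberg2006.IsCofinitelyGenerated Λ D) (hS : S.Finite)
    (ρ₀ : ContinuousRep (absoluteGaloisGroup K) Λ D) (hker : ramificationSubgroup K S ≤ ρ₀.ker)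
    (L₀ : Set (BigGaloisRep.LocalIndex K))
    (hL : ∀ w : HeightOneSpectrum (𝓞 K), w ∉ S → (Sum.inr w : BigGaloisRep.LocalIndex K) ∈ L₀) :
    Module.Finite Λ (CharacterModule (selmer (BigGaloisRep.localMap K) L₀ ρ₀)) :=
  Greenberg2006.isCofinitelyGenerated_iff_module_finite_characterModule.1
    (isCofinitelyGenerated_selmer S e hD hS ρ₀ hker L₀ hL)

end Section

/-! ## §4. The K2 reading: `X = XBig κ ρ 𝔮 Σ` is a finitely generated `Λ_𝒪`-module -/

section K2

variable {K : Type} [Field K] [NumberField K] {p : ℕ} [Fact p.Prime]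
  {𝒪 : Type} [CommRing 𝒪] [TopologicalSpace 𝒪]
  {A : Type} [AddCommGroup A] [Module 𝒪 A] [TopologicalSpace A] [DiscreteTopology A]
  [TopologicalSpace (PowerSeries 𝒪)] [ContinuousSMul (PowerSeries 𝒪) (BigRepModule 𝒪 p A)]

omit [NumberField K] [Fact (Nat.Prime p)] in
/-- The strict index set `strictSet p 𝔮 Σ` contains the inertia index of every `w ∉ S` once
`S ⊇ Σ ∪ {w ∣ p}` (`BigGaloisRep.inr_mem_strictSet_iff`). [cite: Castella2018Erratum, §2 (p. 2, "`S = Σ ∪ S_p`")] -/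
theorem inr_mem_strictSet_of_not_mem (𝔮 : HeightOneSpectrum (𝓞 K)) (Sig S : Set (HeightOneSpectrum (𝓞 K)))
    (hS : ∀ w, w ∉ S → w ∉ Sig ∧ ((p : ℕ) : 𝓞 K) ∉ w.asIdeal) :
    ∀ w : HeightOneSpectrum (𝓞 K), w ∉ S →
      (Sum.inr w : BigGaloisRep.LocalIndex K) ∈ BigGaloisRep.strictSet p 𝔮 Sig :=
  fun w hw ↦ (BigGaloisRep.inr_mem_strictSet_iff p 𝔮 w Sig).mpr (hS w hw)

/-- **W1 (fg) modulo the construction-node inputs: `X^Σ_𝔮 = XBig κ ρ 𝔮 Σ` is a finitely generated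
`Λ_𝒪`-module** whenever `Λ_𝒪 = PowerSeries 𝒪 ≃+* ℤ_p⟦T₁, …, T_m⟧` (K2 branch: `𝒪 = ℤ_p⟦X⟧`, `m = 2`), the big
module `M = A ⊗ Λ_𝒪^*` is cofinitely generated over `Λ_𝒪`, and `M` is unramified outside a finite `S` with
`S ⊇ Σ ∪ {w ∣ p}` (`N_S ≤ ker`). Greenberg 2006 Prop. 3.2 + «Selmer classes are inflated from `G_{K,S}`».
[cite: Greenberg2006, Prop. 3.2 (p. 358 L37)] [cite: Castella2018Erratum, §2 (p. 2–3, "`X^Σ_ac(A_g) = Sel^Σ_𝔭(K, M_g)^*`")] -/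
theorem module_finite_XBig {m : ℕ} (e : PowerSeries 𝒪 ≃+* MvPowerSeries (Fin m) ℤ_[p])
    (κ : ZpExtension K p) (ρ : ContinuousRep (absoluteGaloisGroup K) 𝒪 A)
    (hD : Greenberg2006.IsCofinitelyGenerated (PowerSeries 𝒪) (BigRepModule 𝒪 p A))
    (S : Set (HeightOneSpectrum (𝓞 K))) (hSfin : S.Finite)
    (hker : ramificationSubgroup K S ≤ (AnticyclotomicBigGaloisRep κ ρ).ker)
    (𝔮 : HeightOneSpectrum (𝓞 K)) (Sig : Set (HeightOneSpectrum (𝓞 K)))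
    (hS : ∀ w, w ∉ S → w ∉ Sig ∧ ((p : ℕ) : 𝓞 K) ∉ w.asIdeal) :
    Module.Finite (PowerSeries 𝒪) (BigGaloisRep.XBig κ ρ 𝔮 Sig) :=
  module_finite_characterModule_selmer S e hD hSfin (AnticyclotomicBigGaloisRep κ ρ) hker
    (BigGaloisRep.strictSet p 𝔮 Sig) (inr_mem_strictSet_of_not_mem 𝔮 Sig S hS)

/-- The same in Greenberg's language: `Sel^Σ_𝔮(K, M)` is a cofinitely generated `Λ_𝒪`-module.
[cite: Greenberg2006, Prop. 3.2 (p. 358 L37)] -/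
theorem isCofinitelyGenerated_selmerBig {m : ℕ} (e : PowerSeries 𝒪 ≃+* MvPowerSeries (Fin m) ℤ_[p])
    (κ : ZpExtension K p) (ρ : ContinuousRep (absoluteGaloisGroup K) 𝒪 A)
    (hD : Greenberg2006.IsCofinitelyGenerated (PowerSeries 𝒪) (BigRepModule 𝒪 p A))
    (S : Set (HeightOneSpectrum (𝓞 K))) (hSfin : S.Finite)
    (hker : ramificationSubgroup K S ≤ (AnticyclotomicBigGaloisRep κ ρ).ker)
    (𝔮 : HeightOneSpectrum (𝓞 K)) (Sig : Set (HeightOneSpectrum (𝓞 K)))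
    (hS : ∀ w, w ∉ S → w ∉ Sig ∧ ((p : ℕ) : 𝓞 K) ∉ w.asIdeal) :
    Greenberg2006.IsCofinitelyGenerated (PowerSeries 𝒪) (BigGaloisRep.selmerBig κ ρ 𝔮 Sig) :=
  isCofinitelyGenerated_selmer S e hD hSfin (AnticyclotomicBigGaloisRep κ ρ) hker
    (BigGaloisRep.strictSet p 𝔮 Sig) (inr_mem_strictSet_of_not_mem 𝔮 Sig S hS)

end K2

section K2TwoVar

variable {K : Type} [Field K] [NumberField K]

/-- **The K2 branch case `B = Λ₂ = ℤ_p⟦X⟧⟦T⟧`** (`𝒪 = 𝒪₂ = ℤ_p⟦X⟧`, the weight variable; `T` anticyclotomic):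
`X₂ = XBig κ ρ₂ 𝔮 Σ` is a finitely generated `B`-module, given the cofinite generation of the big module and
unramifiedness outside a finite `S ⊇ Σ ∪ {w ∣ p}` — the ring clause discharged by the tree's
`nonempty_iwasawaAlgebraTwoVar_ringEquiv_mvPowerSeries` (`B ≃+* ℤ_p⟦T₁, T₂⟧`). This is the memo's W1 (fg)
with its two construction-node inputs (a), (b) displayed as hypotheses.
[cite: Greenberg2006, Prop. 3.2 (p. 358 L37)] [cite: Greenberg2016Selmer, §1 p. 4 L11–13] -/
theorem module_finite_XBig_twoVar {p : ℕ} [Fact p.Prime]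
    {A₂ : Type} [AddCommGroup A₂] [Module (PowerSeries ℤ_[p]) A₂] [TopologicalSpace A₂] [DiscreteTopology A₂]
    [TopologicalSpace (PowerSeries ℤ_[p])] [TopologicalSpace (PowerSeries (PowerSeries ℤ_[p]))]
    [ContinuousSMul (PowerSeries (PowerSeries ℤ_[p])) (BigRepModule (PowerSeries ℤ_[p]) p A₂)]
    (κ : ZpExtension K p) (ρ₂ : ContinuousRep (absoluteGaloisGroup K) (PowerSeries ℤ_[p]) A₂)
    (hD : Greenberg2006.IsCofinitelyGenerated (PowerSeries (PowerSeries ℤ_[p]))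
      (BigRepModule (PowerSeries ℤ_[p]) p A₂))
    (S : Set (HeightOneSpectrum (𝓞 K))) (hSfin : S.Finite)
    (hker : ramificationSubgroup K S ≤ (AnticyclotomicBigGaloisRep κ ρ₂).ker)
    (𝔮 : HeightOneSpectrum (𝓞 K)) (Sig : Set (HeightOneSpectrum (𝓞 K)))
    (hS : ∀ w, w ∉ S → w ∉ Sig ∧ ((p : ℕ) : 𝓞 K) ∉ w.asIdeal) :
    Module.Finite (PowerSeries (PowerSeries ℤ_[p])) (BigGaloisRep.XBig κ ρ₂ 𝔮 Sig) :=
  module_finite_XBig (Classical.choice (nonempty_iwasawaAlgebraTwoVar_ringEquiv_mvPowerSeries p)) κ ρ₂ hD S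
    hSfin hker 𝔮 Sig hS

end K2TwoVar

end Summit.BirchSwinnertonDyer.BirchSwinnertonDyer.Theorems.TelescopeK2SelmerCofinite

end
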